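import Literature.NumberTheory.LFunctions.Zhang2022.DetectorShiftPSDPinIndex
import Literature.NumberTheory.LFunctions.Zhang2022.DetectorDictShiftRankOne

/-!
# Zhang (2022) detector main-term forms — the degenerate face `c₀(b) = 0` of the ONE-SIDED and GLUED slots, and the
# complete slot-region map on the sorted positive octant

Y. Zhang, *Discrete mean estimates and the Landau–Siegel zero*, arXiv:2211.02515v1 (2022) [Zhang2022LandauSiegel] —
an unrefereed manuscript under adjudication. **WHAT THIS IS NOT: a claim about its Theorems 1–2, about Landau–Siegel
zeros, about Parity, or about a repaired `Margin232`. The programme SEARCHES and TYPES; no claim about Landau–Siegel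
zeros, Theorems 1–2 of arXiv:2211.02515 or a repaired Margin232 until a kernel theorem says so.**

Cell landau-siegel §E (ls-barrier-p6 g7), KNIFE-EDGES K8–K11 / BARRIER-STATE §2′ N6 (ii). The three slots of the
convention of record for a real shift triple `b` — ONE-SIDED `Det.FormDetPSD (Det.shiftRecipe b)` (E-010, row 17),
GLUED `Det.GluedFormPSD b` (Family B), WINDOWED `Det.DictShiftPSD b` (Family A) — were decided in the kernel on
`{c₀(b) > 0}` (K11 criterion `Det.formDetPSD_shiftRecipe_iff_modes` / `Det.gluedFormPSD_iff_formDetPSD`,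
`DetectorShiftPSDPinIndex`; windowed = Lemma 2.3's box, K8 `Det.dictShiftPSD_iff_signAdmissible`), on `{c₀(b) < 0}`
(all three FAIL, `Det.not_formDetPSD_of_re_sum_shiftW_neg`, `DetectorShiftPSDSharp`), and — for the WINDOWED slot
only — on the hypersurface `{c₀(b) = 0}` (K8-complete `Det.dictShiftPSD_iff_jetTrace_nonneg`: `⇔ λ_b ≥ 0`,
`DetectorDictShiftRankOne`). This file decides the one remaining cell: the ONE-SIDED and GLUED slots on `{c₀(b) = 0}`.

* `Det.exists_kinkedProfile_jets` — the one-sided jet map `g ↦ (∫₀¹ g, g(0))` (over kinked `g` with `g(1) = 0`) is ONTO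
  `ℂ²` (quadratic polynomial witnesses).
* `Det.formDet_shiftRecipe_eq_freeEndForm_of_c0` — on the face the bulk term of K1
  (`Det.formDet_shiftRecipe_eq_bulk_add_freeEnd`, `DetectorShiftClosedForm`) dies:
  `(π/2)·𝔅_{R(b)}(g) = freeEndForm b (∫g) (−g 0)`, a `2 × 2` Hermitian form in the jets with diagonal
  `(−(π³/2)e₃·Im A₀, π·κ_b)` (`Det.freeEndForm_eq_jet`), whose determinant VANISHES on the face
  (`Det.jet_diag_mul_eq_of_c0`, read off the tree's `Det.jetMat_minor_12_12` — cited, not re-derived) and whose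
  diagonal sum with weights `(1, 2)` is `λ_b = Det.jetTrace b` (`Det.jetTrace_eq_diag`).
* **`Det.formDetPSD_shiftRecipe_iff_jetTrace_nonneg_of_c0`** — for `b` with pairwise distinct entries and `c₀(b) = 0`:
  `FormDetPSD (shiftRecipe b) ↔ 0 ≤ λ_b` (⇒ two jet witnesses; ⇐ completing the square with a vanishing determinant).
* **`Det.gluedFormPSD_iff_jetTrace_nonneg_of_c0`**, `Det.gluedFormPSD_iff_formDetPSD_of_c0`,
  `Det.dictShiftPSD_iff_formDetPSD_of_c0` — on the face (with `b_j ≠ 0`) ALL THREE SLOTS COINCIDE (sandwich through the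
  slot hierarchy `DetectorSlotHierarchy` and K8-complete); no `4 × 4` two-point jet analysis is needed for the glued slot.
* **`Det.formDetPSD_shiftRecipe_iff_octant`**, **`Det.gluedFormPSD_iff_octant`**, **`Det.gluedFormPSD_iff_formDetPSD_octant`**
  — for EVERY sorted positive triple `0 < b₀ < b₁ < b₂`, with NO proviso on `c₀(b)`: the one-sided (resp. glued) slot
  holds iff [`c₀ > 0` and K11's modes condition] or [`c₀ = 0` and `λ_b ≥ 0`]; and `GluedFormPSD b ↔ FormDetPSD (shiftRecipe b)`
  (K11's `Det.gluedFormPSD_iff_formDetPSD` without its hypothesis `c₀ > 0`). Together with K8-complete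
  (`Det.dictShiftPSD_iff_complete`) this is the complete slot-region map on the sorted positive octant.
* Kernel points on the face (the tree's instances `Det.jetTrace_234/_137/_246`, `Det.re_atomA0_234`, `Det.atomA0_137/_246`):
  the one-sided and glued slots FAIL at `(2,3,4)` (`λ = −16π − 72π³`) and HOLD at `(1,3,7)` (`λ = 2π`) and `(2,4,6)`
  (`λ = 0`) — three sorted positive triples off Lemma 2.3's box with `c₀ = 0`.

Taxonomy of the main-term quadratic form only: no coverage row, no word, no displayed premise of the class of record
depends on it; 0 definitions, 0 facts, 0 sorries, standard axioms.

References: Y. Zhang, arXiv:2211.02515v1 (2022), §2 Lemma 2.3, (2.13); §4 (4.1); Prop. 7.1 p.44 with (7.2), §8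
(8.11)–(8.23); §12 (12.6)–(12.8); §18 (18.1). [cite: Zhang2022LandauSiegel, §2 Lemma 2.3; Prop 7.1 p.44 with (7.2), (8.11)–(8.23)]
-/

noncomputable section

open Complex Real Set Filter Topology Finset
open scoped ComplexConjugate
open intervalIntegral
open _root_.MeasureTheory

namespace Literature.NumberTheory.LFunctions.Zhang2022

namespace Det

open Repair

/-! ### Part 1 — the one-sided jet map is onto `ℂ²` -/

section Jets

/-- The real quadratic `p(y) = 1 − 4y + 3y² = (1 − y)(1 − 3y)`: `p(0) = 1`, `p(1) = 0`, `∫₀¹ p = 0`; derivative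
`−4 + 6y`. [folklore] -/
private theorem hasDerivAt_jetP (y : ℝ) :
    HasDerivAt (fun y : ℝ => 1 - 4 * y + 3 * y ^ 2) (-4 + 6 * y) y := by
  have h1 := ((hasDerivAt_id y).const_mul (4:ℝ)).const_sub 1
  have h2 := ((hasDerivAt_id y).pow 2).const_mul (3:ℝ)
  exact (h1.add h2).congr_deriv (by simp only [id]; ring)

/-- The real quadratic `q(y) = 6y − 6y² = 6y(1 − y)`: `q(0) = q(1) = 0`, `∫₀¹ q = 1`; derivative `6 − 12y`. [folklore] -/
private theorem hasDerivAt_jetQ (y : ℝ) :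
    HasDerivAt (fun y : ℝ => 6 * y - 6 * y ^ 2) (6 - 12 * y) y := by
  have h1 := (hasDerivAt_id y).const_mul (6:ℝ)
  have h2 := ((hasDerivAt_id y).pow 2).const_mul (6:ℝ)
  exact (h1.sub h2).congr_deriv (by simp only [id]; ring)

/-- Primitive of `p`: `P(y) = y − 2y² + y³`. [folklore] -/
private theorem hasDerivAt_jetPP (y : ℝ) :
    HasDerivAt (fun y : ℝ => y - 2 * y ^ 2 + y ^ 3) (1 - 4 * y + 3 * y ^ 2) y := by
  have h1 := hasDerivAt_id y
  have h2 := ((hasDerivAt_id y).pow 2).const_mul (2:ℝ)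
  have h3 := (hasDerivAt_id y).pow 3
  exact ((h1.sub h2).add h3).congr_deriv (by simp only [id]; ring)

/-- Primitive of `q`: `Q(y) = 3y² − 2y³`. [folklore] -/
private theorem hasDerivAt_jetQQ (y : ℝ) :
    HasDerivAt (fun y : ℝ => 3 * y ^ 2 - 2 * y ^ 3) (6 * y - 6 * y ^ 2) y := by
  have h2 := ((hasDerivAt_id y).pow 2).const_mul (3:ℝ)
  have h3 := ((hasDerivAt_id y).pow 3).const_mul (2:ℝ)
  exact (h2.sub h3).congr_deriv (by simp only [id]; ring)

/-- **The one-sided jet map is onto `ℂ²`:** for every `(x₁, x₂)` there is a kinked (indeed polynomial) profile `g` with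
`g(1) = 0`, `∫₀¹ g = x₁` and `g(0) = x₂` — namely `g = x₂·(1−y)(1−3y) + x₁·6y(1−y)`. So on any locus where the
one-sided main-term form is a form in the two jets `(∫g, g(0))` alone, its positivity on profiles is the positivity of
that `2 × 2` form on `ℂ²`. [cite: Zhang2022LandauSiegel, Prop 7.1 p.44 with (7.2), (8.11)–(8.12)] -/
theorem exists_kinkedProfile_jets (x₁ x₂ : ℂ) :
    ∃ g g' : ℝ → ℂ, KinkedProfile g g' ∧ g 1 = 0 ∧ (∫ y in (0:ℝ)..1, g y) = x₁ ∧ g 0 = x₂ := by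
  refine ⟨fun y => x₂ * (((1 - 4 * y + 3 * y ^ 2 : ℝ)) : ℂ) + x₁ * (((6 * y - 6 * y ^ 2 : ℝ)) : ℂ),
    fun y => x₂ * (((-4 + 6 * y : ℝ)) : ℂ) + x₁ * (((6 - 12 * y : ℝ)) : ℂ), ?_, ?_, ?_, ?_⟩
  · -- kinked profile: polynomial data
    have hd : ∀ y : ℝ, HasDerivAt
        (fun y : ℝ => x₂ * (((1 - 4 * y + 3 * y ^ 2 : ℝ)) : ℂ) + x₁ * (((6 * y - 6 * y ^ 2 : ℝ)) : ℂ))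
        (x₂ * (((-4 + 6 * y : ℝ)) : ℂ) + x₁ * (((6 - 12 * y : ℝ)) : ℂ)) y := fun y =>
      ((hasDerivAt_jetP y).ofReal_comp.const_mul x₂).add ((hasDerivAt_jetQ y).ofReal_comp.const_mul x₁)
    have hc : Continuous
        (fun y : ℝ => x₂ * (((1 - 4 * y + 3 * y ^ 2 : ℝ)) : ℂ) + x₁ * (((6 * y - 6 * y ^ 2 : ℝ)) : ℂ)) :=
      continuous_iff_continuousAt.2 fun y => (hd y).continuousAt
    have hc' : Continuous (fun y : ℝ => x₂ * (((-4 + 6 * y : ℝ)) : ℂ) + x₁ * (((6 - 12 * y : ℝ)) : ℂ)) := by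
      fun_prop
    exact ⟨hc.continuousOn, fun y _ => (hd y).hasDerivWithinAt, memLp_two_of_continuousOn_Icc' hc'.continuousOn⟩
  · push_cast; ring
  · -- `∫₀¹ g = x₂·(P(1) − P(0)) + x₁·(Q(1) − Q(0)) = x₁`
    have hP : ∀ y : ℝ, HasDerivAt
        (fun y : ℝ => x₂ * (((y - 2 * y ^ 2 + y ^ 3 : ℝ)) : ℂ) + x₁ * (((3 * y ^ 2 - 2 * y ^ 3 : ℝ)) : ℂ))
        (x₂ * (((1 - 4 * y + 3 * y ^ 2 : ℝ)) : ℂ) + x₁ * (((6 * y - 6 * y ^ 2 : ℝ)) : ℂ)) y := fun y =>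
      ((hasDerivAt_jetPP y).ofReal_comp.const_mul x₂).add ((hasDerivAt_jetQQ y).ofReal_comp.const_mul x₁)
    have hint : IntervalIntegrable
        (fun y : ℝ => x₂ * (((1 - 4 * y + 3 * y ^ 2 : ℝ)) : ℂ) + x₁ * (((6 * y - 6 * y ^ 2 : ℝ)) : ℂ))
        volume 0 1 := by
      apply Continuous.intervalIntegrable; fun_prop
    rw [intervalIntegral.integral_eq_sub_of_hasDerivAt (fun y _ => hP y) hint]
    push_cast; ring
  · push_cast; ring

end Jets

/-! ### Part 2 — the face identity: on `{c₀(b) = 0}` the one-sided form is the free-end jet form -/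

section Face

variable {b : Fin 3 → ℝ} {g g' : ℝ → ℂ}

/-- Pairwise distinctness from injectivity (indices `0,1`). [folklore] -/
private theorem ne01 (hb : Function.Injective b) : b 0 ≠ b 1 := fun h => absurd (hb h) (by decide)
/-- Pairwise distinctness from injectivity (indices `0,2`). [folklore] -/
private theorem ne02 (hb : Function.Injective b) : b 0 ≠ b 2 := fun h => absurd (hb h) (by decide)
/-- Pairwise distinctness from injectivity (indices `1,2`). [folklore] -/
private theorem ne12 (hb : Function.Injective b) : b 1 ≠ b 2 := fun h => absurd (hb h) (by decide)

/-- **On the face `c₀(b) = 0` the bulk term of K1 dies:** `(π/2)·𝔅_{R(b)}(g) = freeEndForm b (∫₀¹ g) (−g(0))` for every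
one-sided kinked profile (`b` with pairwise distinct entries). [cite: Zhang2022LandauSiegel, Prop 7.1 p.44 with (7.2), (8.11)–(8.23)] -/
theorem formDet_shiftRecipe_eq_freeEndForm_of_c0 (hb : Function.Injective b) (hc : (∑ j : Fin 3, shiftW b j).re = 0)
    (hg : KinkedProfile g g') (hg1 : g 1 = 0) :
    π / 2 * FormDet (shiftRecipe b) g g' = freeEndForm b (∫ y in (0:ℝ)..1, g y) (-g 0) := by
  rw [formDet_shiftRecipe_eq_bulk_add_freeEnd hb hg hg1, hc, zero_mul, zero_add]

/-- **The free-end form in jet coordinates:** `freeEndForm b x₁ x₂ = m₂₂·‖x₁‖² + m₁₁·‖x₂‖² + π²·Re(A_N·x₂·conj x₁)` with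
`m₂₂ = −(π³/2)·e₃·Im A₀` and `m₁₁ = π·κ_b` the diagonal entries `(2,2)`, `(1,1)` of the jet matrix `Det.jetMat b`
(`DetectorDictShiftRankOne`). [cite: Zhang2022LandauSiegel, Prop 7.1 p.44 with (8.11)–(8.23)] -/
theorem freeEndForm_eq_jet (b : Fin 3 → ℝ) (x₁ x₂ : ℂ) :
    freeEndForm b x₁ x₂
      = (-(π ^ 3 / 2 * symE3 b * (atomA0 b).im)) * ‖x₁‖ ^ 2 + π * jetKappa b * ‖x₂‖ ^ 2
        + π ^ 2 * (atomAN b * x₂ * conj x₁).re := by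
  unfold freeEndForm jetKappa symE1 symE3
  ring

/-- **`λ_b` is the weighted diagonal sum `m₂₂ + 2·m₁₁`** of the free-end form. [cite: Zhang2022LandauSiegel, Prop 7.1 p.44 with (8.11)–(8.23); §18 (18.1)] -/
theorem jetTrace_eq_diag (b : Fin 3 → ℝ) :
    jetTrace b = (-(π ^ 3 / 2 * symE3 b * (atomA0 b).im)) + 2 * (π * jetKappa b) := by
  unfold jetTrace; ring

/-- **The determinant of the free-end form vanishes on the face:** `m₁₁·m₂₂ = π⁴‖A_N‖²/4` when `c₀(b) = 0` — the
`(a₁,I | a₁,I)` minor identity `m₁₁m₂₂ − m₁₂m₂₁ = c₀·(π⁴e₃/4)(2Re A_b − e₁c₀)` of the tree (`Det.jetMat_minor_12_12`,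
ls-num-2's `|A_N|² = e₃(e₁|A₀|² − 2Re(A_b·conj A₀))`) read at `c₀ = 0`. [cite: Zhang2022LandauSiegel, Prop 7.1 p.44 with (8.11)–(8.23); §8 (8.13)–(8.18)] -/
theorem jet_diag_mul_eq_of_c0 (hb : Function.Injective b) (hc : (atomA0 b).re = 0) :
    (π * jetKappa b) * (-(π ^ 3 / 2 * symE3 b * (atomA0 b).im)) = π ^ 4 * ‖atomAN b‖ ^ 2 / 4 := by
  have h := jetMat_minor_12_12 b (ne01 hb) (ne02 hb) (ne12 hb)
  rw [hc] at h
  simp only [Complex.ofReal_zero, zero_mul, sub_eq_zero, jetMat_11, jetMat_22, jetMat_12, jetMat_21] at h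
  -- `h : (πκ : ℂ)·(m₂₂ : ℂ) = (−π²A_N/2)·(−π²·conj A_N/2)`
  have hm : atomAN b * conj (atomAN b) = ((‖atomAN b‖ : ℝ) : ℂ) ^ 2 := Complex.mul_conj' _
  have h' : (((π * jetKappa b) * (-(π ^ 3 / 2 * symE3 b * (atomA0 b).im)) : ℝ) : ℂ)
      = (((π ^ 4 * ‖atomAN b‖ ^ 2 / 4 : ℝ)) : ℂ) := by
    push_cast at h ⊢
    linear_combination h + (π : ℂ) ^ 4 / 4 * hm
  exact_mod_cast h'

/-- **PSD on the face when `λ_b ≥ 0`:** with a vanishing determinant and `m₂₂ + 2m₁₁ = λ_b ≥ 0` both diagonal entries are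
`≥ 0`, and `m₂₂‖x₁‖² + m₁₁‖x₂‖² ≥ 2√(m₁₁m₂₂)‖x₁‖‖x₂‖ = π²‖A_N‖‖x₁‖‖x₂‖ ≥ −π²Re(A_N x₂ conj x₁)`.
[cite: Zhang2022LandauSiegel, Prop 7.1 p.44 with (8.11)–(8.23); §18 (18.1)] -/
theorem freeEndForm_nonneg_of_c0 (hb : Function.Injective b) (hc : (atomA0 b).re = 0) (hl : 0 ≤ jetTrace b)
    (x₁ x₂ : ℂ) : 0 ≤ freeEndForm b x₁ x₂ := by
  rw [freeEndForm_eq_jet]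
  set a : ℝ := -(π ^ 3 / 2 * symE3 b * (atomA0 b).im) with ha
  set c : ℝ := π * jetKappa b with hc'
  have hdet : c * a = π ^ 4 * ‖atomAN b‖ ^ 2 / 4 := jet_diag_mul_eq_of_c0 hb hc
  have htr : jetTrace b = a + 2 * c := jetTrace_eq_diag b
  have hac : 0 ≤ c * a := by rw [hdet]; positivity
  -- both diagonal entries are `≥ 0`
  have ha0 : 0 ≤ a := by
    by_contra h
    push Not at h
    have : c ≤ 0 := by
      by_contra h'
      push Not at h'
      nlinarith [mul_neg_of_pos_of_neg h' h]
    linarith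
  have hc0 : 0 ≤ c := by
    by_contra h
    push Not at h
    have : a ≤ 0 := by
      by_contra h'
      push Not at h'
      nlinarith [mul_neg_of_neg_of_pos h h']
    linarith
  -- the cross term is bounded by `π²‖A_N‖‖x₁‖‖x₂‖`
  set u : ℝ := ‖x₁‖ with hu
  set v : ℝ := ‖x₂‖ with hv
  have hu0 : 0 ≤ u := norm_nonneg _
  have hv0 : 0 ≤ v := norm_nonneg _
  set s : ℝ := π ^ 2 * ‖atomAN b‖ with hs
  have hs0 : 0 ≤ s := by positivity
  have hs2 : s ^ 2 = 4 * (a * c) := by rw [hs, mul_comm a c, hdet]; ring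
  have hcross : -(s * u * v) ≤ π ^ 2 * (atomAN b * x₂ * conj x₁).re := by
    have h1 : |(atomAN b * x₂ * conj x₁).re| ≤ ‖atomAN b * x₂ * conj x₁‖ := Complex.abs_re_le_norm _
    have h2 : ‖atomAN b * x₂ * conj x₁‖ = ‖atomAN b‖ * v * u := by
      rw [norm_mul, norm_mul, Complex.norm_conj]
    rw [h2] at h1
    have h3 := (abs_le.1 h1).1
    have : s * u * v = π ^ 2 * (‖atomAN b‖ * v * u) := by rw [hs]; ring
    rw [this]
    nlinarith [h3, sq_nonneg π]
  -- AM–GM with the exact determinant: `a u² + c v² ≥ s u v`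
  have hamgm : s * u * v ≤ a * u ^ 2 + c * v ^ 2 := by
    have hL : 0 ≤ a * u ^ 2 + c * v ^ 2 := by positivity
    have hsq : (s * u * v) ^ 2 ≤ (a * u ^ 2 + c * v ^ 2) ^ 2 := by
      have : (a * u ^ 2 + c * v ^ 2) ^ 2 - (s * u * v) ^ 2 = (a * u ^ 2 - c * v ^ 2) ^ 2 := by
        rw [mul_pow, mul_pow, hs2]; ring
      nlinarith [sq_nonneg (a * u ^ 2 - c * v ^ 2)]
    exact le_of_pow_le_pow_left₀ two_ne_zero hL hsq
  nlinarith [hamgm, hcross]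

/-- **⇐ on the face:** `c₀(b) = 0` and `λ_b ≥ 0` ⇒ `FormDetPSD (shiftRecipe b)` (`b` with pairwise distinct entries; no
`b_j ≠ 0` needed). [cite: Zhang2022LandauSiegel, Prop 7.1 p.44 with (7.2), (8.11)–(8.23); §18 (18.1)] -/
theorem formDetPSD_shiftRecipe_of_c0_of_jetTrace_nonneg (hb : Function.Injective b)
    (hc : (∑ j : Fin 3, shiftW b j).re = 0) (hl : 0 ≤ jetTrace b) : FormDetPSD (shiftRecipe b) := by
  intro g g' hg hg1
  have hK := formDet_shiftRecipe_eq_freeEndForm_of_c0 hb hc hg hg1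
  have hnn := freeEndForm_nonneg_of_c0 hb hc hl (∫ y in (0:ℝ)..1, g y) (-g 0)
  have hπ : 0 < π / 2 := by positivity
  nlinarith [hK, hnn]

/-- **⇒ on the face (contrapositive):** `c₀(b) = 0` and `λ_b < 0` ⇒ `¬ FormDetPSD (shiftRecipe b)`. If `κ_b < 0` the jet
witness `(∫g, g 0) = (0, 1)` gives `(π/2)𝔅 = π·κ_b < 0`; otherwise `m₂₂ = λ_b − 2πκ_b < 0` and the witness `(1, 0)`
gives `(π/2)𝔅 = m₂₂ < 0`. [cite: Zhang2022LandauSiegel, Prop 7.1 p.44 with (7.2), (8.11)–(8.23); §18 (18.1)] -/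
theorem not_formDetPSD_shiftRecipe_of_c0_of_jetTrace_neg (hb : Function.Injective b)
    (hc : (∑ j : Fin 3, shiftW b j).re = 0) (hl : jetTrace b < 0) : ¬ FormDetPSD (shiftRecipe b) := by
  intro hpsd
  have htr := jetTrace_eq_diag b
  by_cases hκ : jetKappa b < 0
  · obtain ⟨g, g', hg, hg1, hI, h0⟩ := exists_kinkedProfile_jets 0 1
    have hval := hpsd g g' hg hg1
    have hK := formDet_shiftRecipe_eq_freeEndForm_of_c0 hb hc hg hg1
    rw [hI, h0, freeEndForm_eq_jet] at hK
    simp only [norm_zero, norm_neg, norm_one, map_zero, mul_zero, Complex.zero_re, one_pow, mul_one,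
      zero_pow two_ne_zero, add_zero] at hK
    have hπ : 0 < π / 2 := by positivity
    nlinarith [mul_nonneg hπ.le hval, mul_neg_of_pos_of_neg Real.pi_pos hκ]
  · push Not at hκ
    obtain ⟨g, g', hg, hg1, hI, h0⟩ := exists_kinkedProfile_jets 1 0
    have hval := hpsd g g' hg hg1
    have hK := formDet_shiftRecipe_eq_freeEndForm_of_c0 hb hc hg hg1
    rw [hI, h0, freeEndForm_eq_jet] at hK
    simp only [norm_one, neg_zero, norm_zero, mul_zero, zero_mul, Complex.zero_re, one_pow, mul_one,
      zero_pow two_ne_zero, add_zero] at hK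
    have hπ : 0 < π / 2 := by positivity
    nlinarith [mul_nonneg hπ.le hval, mul_nonneg Real.pi_pos.le hκ]

/-- **THE FACE CRITERION, ONE-SIDED SLOT.** For a real shift triple with pairwise distinct entries on the hypersurface
`c₀(b) = Re Σ_j W_j(b) = 0`: `Det.FormDetPSD (Det.shiftRecipe b) ↔ 0 ≤ λ_b` (`λ_b = Det.jetTrace b`) — the same real number
that decides the windowed slot there (K8-complete `Det.dictShiftPSD_iff_jetTrace_nonneg`).
[cite: Zhang2022LandauSiegel, §2 Lemma 2.3; Prop 7.1 p.44 with (7.2), (8.11)–(8.23); §18 (18.1)] -/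
theorem formDetPSD_shiftRecipe_iff_jetTrace_nonneg_of_c0 (hb : Function.Injective b)
    (hc : (∑ j : Fin 3, shiftW b j).re = 0) : FormDetPSD (shiftRecipe b) ↔ 0 ≤ jetTrace b :=
  ⟨fun h => by
    by_contra hlt
    push Not at hlt
    exact not_formDetPSD_shiftRecipe_of_c0_of_jetTrace_neg hb hc hlt h,
   fun h => formDetPSD_shiftRecipe_of_c0_of_jetTrace_nonneg hb hc h⟩

/-! ### Part 3 — on the face all three slots coincide (`b_j ≠ 0`) -/

/-- **THE FACE CRITERION, GLUED SLOT:** on `{c₀(b) = 0}` (pairwise distinct `b`, `b_j ≠ 0`) `Det.GluedFormPSD b ↔ 0 ≤ λ_b`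
— sandwiched between the windowed slot (K8-complete) and the one-sided slot (Part 2) through the hierarchy
`Det.DictShiftPSD.gluedFormPSD` / `Det.GluedFormPSD.formDetPSD`. [cite: Zhang2022LandauSiegel, §2 Lemma 2.3; §4 (4.1); Prop 7.1 p.44 with (7.2); §12 (12.6)–(12.8); §18 (18.1)] -/
theorem gluedFormPSD_iff_jetTrace_nonneg_of_c0 (hb : Function.Injective b) (hb0 : ∀ j, b j ≠ 0)
    (hc : (∑ j : Fin 3, shiftW b j).re = 0) : GluedFormPSD b ↔ 0 ≤ jetTrace b :=
  ⟨fun h => (formDetPSD_shiftRecipe_iff_jetTrace_nonneg_of_c0 hb hc).1 h.formDetPSD,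
   fun h => ((dictShiftPSD_iff_jetTrace_nonneg b (ne01 hb) (ne02 hb) (ne12 hb) hb0 hc).2 h).gluedFormPSD hb0⟩

/-- **On the face, glued = one-sided.** [cite: Zhang2022LandauSiegel, Prop 7.1 p.44 with (7.2); §12 (12.6)–(12.8); §18 (18.1)] -/
theorem gluedFormPSD_iff_formDetPSD_of_c0 (hb : Function.Injective b) (hb0 : ∀ j, b j ≠ 0)
    (hc : (∑ j : Fin 3, shiftW b j).re = 0) : GluedFormPSD b ↔ FormDetPSD (shiftRecipe b) := by
  rw [gluedFormPSD_iff_jetTrace_nonneg_of_c0 hb hb0 hc, formDetPSD_shiftRecipe_iff_jetTrace_nonneg_of_c0 hb hc]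

/-- **On the face, windowed = one-sided** (so windowed = glued = one-sided there; everywhere else on the octant the windowed
region is strictly smaller, K8/K11). [cite: Zhang2022LandauSiegel, §2 Lemma 2.3; §4 (4.1); Prop 7.1 p.44 with (7.2); §18 (18.1)] -/
theorem dictShiftPSD_iff_formDetPSD_of_c0 (hb : Function.Injective b) (hb0 : ∀ j, b j ≠ 0)
    (hc : (∑ j : Fin 3, shiftW b j).re = 0) : DictShiftPSD b ↔ FormDetPSD (shiftRecipe b) := by
  rw [dictShiftPSD_iff_jetTrace_nonneg b (ne01 hb) (ne02 hb) (ne12 hb) hb0 hc,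
    formDetPSD_shiftRecipe_iff_jetTrace_nonneg_of_c0 hb hc]

/-- **On the face, windowed = glued.** [cite: Zhang2022LandauSiegel, §4 (4.1); §12 (12.6)–(12.8); §18 (18.1)] -/
theorem dictShiftPSD_iff_gluedFormPSD_of_c0 (hb : Function.Injective b) (hb0 : ∀ j, b j ≠ 0)
    (hc : (∑ j : Fin 3, shiftW b j).re = 0) : DictShiftPSD b ↔ GluedFormPSD b := by
  rw [dictShiftPSD_iff_formDetPSD_of_c0 hb hb0 hc, gluedFormPSD_iff_formDetPSD_of_c0 hb hb0 hc]

end Face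

/-! ### Part 4 — the complete slot-region map on the sorted positive octant (no proviso on `c₀`) -/

section Octant

variable {b : Fin 3 → ℝ}

/-- **THE SLOT-REGION MAP, ONE-SIDED SLOT, WHOLE OCTANT.** For every sorted positive triple `0 < b₀ < b₁ < b₂` (no
hypothesis on `c₀(b)`): `Det.FormDetPSD (Det.shiftRecipe b)` holds iff EITHER `c₀(b) > 0` and K11's modes condition
([every lattice mode `≥ 0`] ∨ [one negative mode, all other non-zero modes positive, finitary pin index `≤ 0`],
`Det.formDetPSD_shiftRecipe_iff_modes` verbatim) OR `c₀(b) = 0` and `λ_b ≥ 0` (Part 2); `c₀(b) < 0` always fails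
(`Det.not_formDetPSD_of_re_sum_shiftW_neg`). [cite: Zhang2022LandauSiegel, §2 Lemma 2.3; Prop 7.1 p.44 with (7.2), (8.11)–(8.23); §18 (18.1)] -/
theorem formDetPSD_shiftRecipe_iff_octant (hb₀ : 0 < b 0) (h01 : b 0 < b 1) (h12 : b 1 < b 2) :
    FormDetPSD (shiftRecipe b) ↔
      (0 < (∑ j : Fin 3, shiftW b j).re ∧
        ((∀ m : ℤ, 0 ≤ latticeSymbol b m) ∨
          (∃ m₀ : ℤ, latticeSymbol b m₀ < 0 ∧ (∀ m : ℤ, m ≠ 0 → m ≠ m₀ → 0 < latticeSymbol b m) ∧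
            ∀ t : Finset ℤ, (∀ m ∈ t, m ≠ 0 ∧ m ≠ m₀) →
              |latticeSymbol b m₀| * ∑ m ∈ t, (m : ℝ) ^ 2 / latticeSymbol b m ≤ (m₀ : ℝ) ^ 2))) ∨
      ((∑ j : Fin 3, shiftW b j).re = 0 ∧ 0 ≤ jetTrace b) := by
  have hb := injective_of_sorted h01 h12
  have he2 : 0 ≤ b 0 * b 1 + b 1 * b 2 + b 2 * b 0 := by
    have h1 : 0 < b 1 := hb₀.trans h01
    have h2 : 0 < b 2 := h1.trans h12
    positivity
  rcases lt_trichotomy ((∑ j : Fin 3, shiftW b j).re) 0 with hneg | hzero | hpos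
  · constructor
    · intro h; exact absurd h (not_formDetPSD_of_re_sum_shiftW_neg hb he2 hneg)
    · rintro (⟨hp, -⟩ | ⟨hz, -⟩) <;> linarith
  · rw [formDetPSD_shiftRecipe_iff_jetTrace_nonneg_of_c0 hb hzero]
    constructor
    · intro h; exact Or.inr ⟨hzero, h⟩
    · rintro (⟨hp, -⟩ | ⟨-, h⟩)
      · linarith
      · exact h
  · rw [formDetPSD_shiftRecipe_iff_modes hb₀ h01 h12 hpos]
    constructor
    · intro h; exact Or.inl ⟨hpos, h⟩
    · rintro (⟨-, h⟩ | ⟨hz, -⟩)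
      · exact h
      · linarith

/-- **THE SLOT-REGION MAP, GLUED SLOT, WHOLE OCTANT** — the same disjunction decides Family B's no-overlap glued slot
`Det.GluedFormPSD b` for every sorted positive triple (K11 `Det.gluedFormPSD_iff_modes` on `{c₀ > 0}`, Part 3 on the
face, the hierarchy on `{c₀ < 0}`). [cite: Zhang2022LandauSiegel, §2 Lemma 2.3; Prop 7.1 p.44 with (7.2), (8.11)–(8.23); §12 (12.6)–(12.8); §18 (18.1)] -/
theorem gluedFormPSD_iff_octant (hb₀ : 0 < b 0) (h01 : b 0 < b 1) (h12 : b 1 < b 2) :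
    GluedFormPSD b ↔
      (0 < (∑ j : Fin 3, shiftW b j).re ∧
        ((∀ m : ℤ, 0 ≤ latticeSymbol b m) ∨
          (∃ m₀ : ℤ, latticeSymbol b m₀ < 0 ∧ (∀ m : ℤ, m ≠ 0 → m ≠ m₀ → 0 < latticeSymbol b m) ∧
            ∀ t : Finset ℤ, (∀ m ∈ t, m ≠ 0 ∧ m ≠ m₀) →
              |latticeSymbol b m₀| * ∑ m ∈ t, (m : ℝ) ^ 2 / latticeSymbol b m ≤ (m₀ : ℝ) ^ 2))) ∨
      ((∑ j : Fin 3, shiftW b j).re = 0 ∧ 0 ≤ jetTrace b) := by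
  have hb := injective_of_sorted h01 h12
  have h1 : 0 < b 1 := hb₀.trans h01
  have h2 : 0 < b 2 := h1.trans h12
  have hb0 : ∀ j, b j ≠ 0 := by
    intro j; fin_cases j
    · exact hb₀.ne'
    · exact h1.ne'
    · exact h2.ne'
  have he2 : 0 ≤ b 0 * b 1 + b 1 * b 2 + b 2 * b 0 := by positivity
  rcases lt_trichotomy ((∑ j : Fin 3, shiftW b j).re) 0 with hneg | hzero | hpos
  · constructor
    · intro h
      exact absurd h (not_gluedFormPSD_of_not_formDetPSD (not_formDetPSD_of_re_sum_shiftW_neg hb he2 hneg))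
    · rintro (⟨hp, -⟩ | ⟨hz, -⟩) <;> linarith
  · rw [gluedFormPSD_iff_jetTrace_nonneg_of_c0 hb hb0 hzero]
    constructor
    · intro h; exact Or.inr ⟨hzero, h⟩
    · rintro (⟨hp, -⟩ | ⟨-, h⟩)
      · linarith
      · exact h
  · rw [gluedFormPSD_iff_modes hb₀ h01 h12 hpos]
    constructor
    · intro h; exact Or.inl ⟨hpos, h⟩
    · rintro (⟨-, h⟩ | ⟨hz, -⟩)
      · exact h
      · linarith

/-- **GLUED = ONE-SIDED ON THE WHOLE SORTED POSITIVE OCTANT** — K11's `Det.gluedFormPSD_iff_formDetPSD` without its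
hypothesis `c₀(b) > 0`: the no-overlap glued slot region of Family B IS the one-sided E-010 slot region.
[cite: Zhang2022LandauSiegel, §2 Lemma 2.3; Prop 7.1 p.44 with (7.2); §12 (12.6)–(12.8); §18 (18.1)] -/
theorem gluedFormPSD_iff_formDetPSD_octant (hb₀ : 0 < b 0) (h01 : b 0 < b 1) (h12 : b 1 < b 2) :
    GluedFormPSD b ↔ FormDetPSD (shiftRecipe b) := by
  rw [gluedFormPSD_iff_octant hb₀ h01 h12, formDetPSD_shiftRecipe_iff_octant hb₀ h01 h12]

end Octant

/-! ### Part 5 — kernel points on the face -/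

section Points

/-- `(2,3,4)` has pairwise distinct entries. [folklore] -/
private theorem injective_234 : Function.Injective ![(2:ℝ), 3, 4] :=
  injective_of_sorted (by norm_num) (by norm_num [Matrix.cons_val_two, Matrix.tail_cons, Matrix.head_cons])
/-- `(1,3,7)` has pairwise distinct entries. [folklore] -/
private theorem injective_137 : Function.Injective ![(1:ℝ), 3, 7] :=
  injective_of_sorted (by norm_num) (by norm_num [Matrix.cons_val_two, Matrix.tail_cons, Matrix.head_cons])
/-- `(2,4,6)` has pairwise distinct entries. [folklore] -/
private theorem injective_246 : Function.Injective ![(2:ℝ), 4, 6] :=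
  injective_of_sorted (by norm_num) (by norm_num [Matrix.cons_val_two, Matrix.tail_cons, Matrix.head_cons])

/-- **At `b = (2,3,4)` (sorted positive, off Lemma 2.3's box, `c₀ = 0`, `λ = −16π − 72π³ < 0`) the ONE-SIDED slot FAILS**
— the tree had only the windowed verdict there (`Det.not_dictShiftPSD_234`). [cite: Zhang2022LandauSiegel, §2 Lemma 2.3; Prop 7.1 p.44 with (7.2), (8.11)–(8.23); §18 (18.1)] -/
theorem not_formDetPSD_shiftRecipe_234 : ¬ FormDetPSD (shiftRecipe ![2, 3, 4]) :=
  not_formDetPSD_shiftRecipe_of_c0_of_jetTrace_neg injective_234 re_atomA0_234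
    (by rw [jetTrace_234]; nlinarith [Real.pi_pos, pow_pos Real.pi_pos 3])

/-- … hence the GLUED slot fails at `(2,3,4)` too. [cite: Zhang2022LandauSiegel, Prop 7.1 p.44 with (7.2); §18 (18.1)] -/
theorem not_gluedFormPSD_234 : ¬ GluedFormPSD ![2, 3, 4] :=
  not_gluedFormPSD_of_not_formDetPSD not_formDetPSD_shiftRecipe_234

/-- **At `b = (1,3,7)` (sorted positive, NOT sign-admissible, `c₀ = 0`, `λ = 2π > 0`) the ONE-SIDED slot HOLDS.**
[cite: Zhang2022LandauSiegel, §2 Lemma 2.3; Prop 7.1 p.44 with (7.2), (8.11)–(8.23); §18 (18.1)] -/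
theorem formDetPSD_shiftRecipe_137 : FormDetPSD (shiftRecipe ![1, 3, 7]) :=
  formDetPSD_shiftRecipe_of_c0_of_jetTrace_nonneg injective_137
    (show (atomA0 ![(1:ℝ), 3, 7]).re = 0 by rw [atomA0_137]; rfl)
    (by rw [jetTrace_137]; positivity)

/-- … and the GLUED slot holds at `(1,3,7)`. [cite: Zhang2022LandauSiegel, Prop 7.1 p.44 with (7.2); §12 (12.6)–(12.8); §18 (18.1)] -/
theorem gluedFormPSD_137 : GluedFormPSD ![1, 3, 7] :=
  dictShiftPSD_137.gluedFormPSD (by intro j; fin_cases j <;> norm_num [Matrix.cons_val_two, Matrix.tail_cons, Matrix.head_cons])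

/-- **At `b = (2,4,6)` (sorted positive, NOT sign-admissible, `c₀ = 0`, `λ = 0`: the boundary case) the ONE-SIDED slot HOLDS.**
[cite: Zhang2022LandauSiegel, §2 Lemma 2.3; Prop 7.1 p.44 with (7.2), (8.11)–(8.23); §18 (18.1)] -/
theorem formDetPSD_shiftRecipe_246 : FormDetPSD (shiftRecipe ![2, 4, 6]) :=
  formDetPSD_shiftRecipe_of_c0_of_jetTrace_nonneg injective_246
    (show (atomA0 ![(2:ℝ), 4, 6]).re = 0 by rw [atomA0_246]; rfl)
    (by rw [jetTrace_246])

/-- … and the GLUED slot holds at `(2,4,6)`. [cite: Zhang2022LandauSiegel, Prop 7.1 p.44 with (7.2); §12 (12.6)–(12.8); §18 (18.1)] -/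
theorem gluedFormPSD_246 : GluedFormPSD ![2, 4, 6] :=
  dictShiftPSD_and_not_signAdmissible_246.1.gluedFormPSD
    (by intro j; fin_cases j <;> norm_num [Matrix.cons_val_two, Matrix.tail_cons, Matrix.head_cons])

/-- **One-sided slot HOLDS off the box ON THE FACE:** `(1,3,7)` is not sign-admissible (`b₀ = 1` but `[3,7]` straddles
integers) yet `FormDetPSD (shiftRecipe (1,3,7))` — the face companion of the `c₀ > 0` point `b♭ = (1/2,5/2,13/4)`
(`Det.formDetPSD_shiftRecipe_offBoxTriple`). [cite: Zhang2022LandauSiegel, §2 Lemma 2.3; Prop 7.1 p.44 with (7.2), (8.11)–(8.23)] -/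
theorem formDetPSD_and_not_signAdmissible_137 :
    FormDetPSD (shiftRecipe ![1, 3, 7]) ∧ ¬ SignAdmissible ![1, 3, 7] :=
  ⟨formDetPSD_shiftRecipe_137, not_signAdmissible_137⟩

end Points

end Det

end Literature.NumberTheory.LFunctions.Zhang2022

end
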